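import Literature.AlgebraicGeometry.HodgeTheory.HodgeSheafWedge
import Literature.AlgebraicGeometry.HodgeTheory.AtiyahClassTraceNaturality
import HarnessLib

/-!
# The higher Buchweitz–Flenner semiregularity components `σ_q : Ext²(E, E) → H^{q+2}(X, Ω^q_{X/S})`
# on real carriers (`SemiregularityHigherSigma`)

For a commutative ring `S`, an `S`-scheme `X : Over (Spec S)` and a finite locally free `𝒪_X`-module `E`
(`Motives.IsFiniteLocallyFree E`), `HodgeTheory/AtiyahClassTraceReal.lean` constructs the components
`σ_0 = Tr : Ext²(E, E) → H²(X, 𝒪_X)` and `σ_1 = Tr(At(E) ∘ –) : Ext²(E, E) → H³(X, Ω¹_{X/S})` of the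
Buchweitz–Flenner semiregularity map and flags the higher ones as "Not here: `σ_q` for `q ≥ 2` (needs
`Ω^q = Λ^q Ω¹` … and the Yoneda–exterior algebra on `⊕ Extⁱ(E, E ⊗ Ω^j)`)". This file CONSTRUCTS them — no
hypothesis structures, no named facts, every `def` has a body — on REAL carriers: Mathlib's `Abelian.Ext` in
`X.Modules` and the tree's Hodge cohomology `Motives.hodgeCohomology X q (q + 2) = H^{q+2}(X, Ω^q_{X/S})`
(`Ω^q = ⋀^q Ω¹`, `Motives/HodgeSheaves.lean`):

* `twistHodge E j = 𝓗om(E^∨, Ωʲ)` — the model of `E ⊗ Ωʲ` (canonically isomorphic for `E` finite locally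
  free, Hartshorne II Ex. 5.1 (b); the same modelling as `twistCotangent E = 𝓗om(E^∨, Ω¹)` of
  `HodgeTheory/AtiyahClass.lean`);
* `wedgeD E j U a φ = da ∧ φ` — the twisting term, from the wedge `∧ : Ωʲ → 𝓗om(Ω¹, Ωʲ⁺¹)` of
  `HodgeTheory/HodgeSheafWedge.lean`, with its calculus (additive, Leibniz `D(ab, φ) = a D(b, φ) + b D(a, φ)`,
  compatible with restriction);
* `TwistJetSections E j U`, `twistJetModule E j = Pʲ(E)` — the `𝒪_X`-module of pairs `(φ, ψ)`,
  `φ ∈ E ⊗ Ωʲ`, `ψ ∈ E ⊗ Ωʲ⁺¹`, with the TWISTED structure `a • (φ, ψ) = (a φ, a ψ + da ∧ φ)` (a sheaf: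
  `isSheaf_twistJetPresheaf`), the exact sequence
  `0 → E ⊗ Ωʲ⁺¹ → Pʲ(E) → E ⊗ Ωʲ → 0` (`twistJetShortComplex_shortExact`) and its Yoneda class
  **`atiyahClassStep E j ∈ Ext¹(E ⊗ Ωʲ, E ⊗ Ωʲ⁺¹)`** (Mathlib `ShortExact.extClass`). For `E` finite locally
  free this class is `At(E) ⊗ 1_{Ωʲ}` followed by the product `Ω¹ ⊗ Ωʲ → Ωʲ⁺¹`, i.e. the multiplication by
  `At(E)` in BF's algebra `A = ⊕_{i,j} Ext^{i}(E, E ⊗ Ωʲ)` (§4: "associative but in general not graded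
  commutative"): in a local frame `(e_i)` of `E` the `𝒪`-linear local splittings `Σ e_i ⊗ ω_i ↦ (Σ e_i ⊗ ω_i,
  Σ e_i ⊗ dω_i)` of `Pʲ(E)` differ on overlaps by `Σ_{i,k} e_i ⊗ (dg_{ik} ∧ ω'_k)`, the Atiyah cocycle
  `g⁻¹dg` wedged onto the form part — for `j = 0` verbatim Atiyah's `b(E)`;
* `atiyahClassPower E q ∈ Ext^q(E ⊗ Ω⁰, E ⊗ Ω^q)` — the Yoneda powers `At(E)^q = at_{q-1} ∘ ⋯ ∘ at_0`
  (`At⁰ = id`), and `toTwistHodgeZero E : E → E ⊗ Ω⁰` (biduality `E → E^∨∨`, Hartshorne II Ex. 5.1 (a), and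
  `𝒪_X ≅ Ω⁰`);
* **`sigmaHigher hE q : Ext²(E, E) →+ hodgeCohomology X q (q + 2)`**, `σ_q(x) = Tr_{Ω^q}(x · At(E)^q)` — the
  trace with coefficients `Ω^q` (`traceCoeffToCohomology`, `AtiyahClassTraceReal.lean`) of the Yoneda
  composite `E →x E[2] → E ⊗ Ω⁰[2] →At^q E ⊗ Ω^q[q+2]`; `sigmaHigher_apply`;
* `IsHigherSemiregular hE q` (`σ_q` injective: BF §1 "`k`-semiregular") and `IsISemiregular hE I`
  (`(σ_q)_{q ∈ I}` jointly injective: BF §5 "`I`-semiregular"; `I = {q | q < p}` is the p-adic notion of the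
  consumer), with `isHigherSemiregular_iff_isISemiregular_singleton`, `IsISemiregular.mono`.

FAITHFULNESS, PROVED (the new `σ_q` extend the tree's `σ_0`, `σ_1`):
* `atiyahClass_comp_hodgeSheafOneIso_inv` — **the first Atiyah step IS the Atiyah class**: in
  `Ext¹(E, 𝓗om(E^∨, ⋀¹ Ω¹))`, `At(E) · (Ω¹ ≅ ⋀¹Ω¹)⁻¹ = ι · at_0(E)` with `ι = toTwistHodgeZero E`, via the
  explicit morphism of extensions `jetToTwistJetHom : (Atiyah sequence of AtiyahClass.lean) → (Ω⁰-twisted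
  sequence)` and naturality of `extClass`;
* `hodgeCohomologyOneAddEquiv_sigmaHigher_one` — `σ_1` of this file corresponds to `AtiyahClassTraceReal.sigmaOne`
  under `H³(X, ⋀¹ Ω¹) ≃+ hodgeCohomologyOne X 3` (`Motives.hodgeCohomologyOneAddEquiv`);
* `hodgeCohomologyZeroAddEquiv_sigmaHigher_zero` — `σ_0` corresponds to `sigmaZero = Tr` under
  `H²(X, Ω⁰) ≃+ H²(X, 𝒪_X)`.
(Both use the naturality of the trace in the coefficients, `HodgeTheory/AtiyahClassTraceNaturality.lean`.)

## Sources

* [BuchweitzFlenner2003] R.-O. Buchweitz, H. Flenner, *A semiregularity map for modules and applications to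
  deformations*, Compositio Math. 137 (2003): §1 (`σ_0`, "`ℱ` is `k`-semiregular if the component `σ_k` of `σ`
  is injective"), §3 (Atiyah class `At(F) ∈ Ext¹_X(F, F ⊗ Ω¹_X)`), §4 Def. 4.1
  (`σ := Tr(∗ · exp(-At(ℱ))) : Ext²_X(ℱ, ℱ) → ∏_k H^{k+2}(X, Λ^k 𝕃_{X/Y})`; the algebra
  `A = ⊕ Ext^{i+j}_X(ℱ, ℱ ⊗ Λ^j 𝕃)`, "associative but in general not graded commutative"; the trace
  `Tr : Ext^k_X(ℱ, ℱ ⊗ 𝒢) → H^k(X, 𝒢)`), §5 ("`ℰ₀` is called `I`-semiregular if the part `σ_I` of the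
  semiregularity map is injective").
* [BandieraLepriManetti2023] R. Bandiera, E. Lepri, M. Manetti, *L∞ liftings of semiregularity maps via
  Chern–Simons classes*, Adv. Math. 435 (2023), §1: `τ_k(x) = ((-1)^k/k!) Tr(At(F)^k x)`.
* [Hartshorne1977] II Ex. 5.1 (a), (b) (`E^∨∨ ≅ E`, `𝓗om(E^∨, G) ≅ E ⊗ G` for `E` locally free of finite rank).

## Design and scope

* `X/S` is any `S`-scheme and `Ω¹_{X/S}` the cotangent SHEAF, as for `σ_1` in `AtiyahClassTraceReal` (BF work
  with the cotangent complex `𝕃`; for `X/S` smooth `Λ^q 𝕃 = Ω^q`). All constructions (`twistJetModule`,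
  `atiyahClassStep`, `atiyahClassPower`) are stated for every `𝒪_X`-module `E`; their meaning as
  `At(E)^q` on `E ⊗ Ω^q` and the trace need `E` finite locally free (`hE`, an explicit hypothesis of
  `sigmaHigher`).
* NORMALISATION: `sigmaHigher hE q` is `Tr(x · At(E)^q)` WITHOUT the scalar `(-1)^q/q!` of `exp(-At)` (BF) /
  `τ_q` (BLM): the targets `H^{q+2}(X, Ω^q)` are only abelian groups here (no `S`-module structure at the
  pin), and `1/q!` does not exist integrally. Whenever `q!` is invertible on `H^{q+2}(X, Ω^q)` — e.g. `X` a
  `k`-scheme, `char k = p`, `q < p`, the only degrees in which BF's `σ_q` is defined in characteristic `p` —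
  the two maps have the same kernel, so `IsHigherSemiregular` / `IsISemiregular` are BF's notions. Signs:
  the ordering of the `1`-form factors in `At^q` (new factor wedged on the LEFT, `da ∧ φ`) fixes `At^q` up to
  the sign conventions of the literature, irrelevant for kernels.
* `σ_0`, `σ_1` of this file live on `H^•(X, Ω⁰)`, `H^•(X, ⋀¹ Ω¹)`; the PROVED comparisons above transport them
  to the carriers of `AtiyahClassTraceReal` — consumers wanting literally `sigmaZero`/`sigmaOne` in degrees
  `0, 1` and `sigmaHigher` in degrees `≥ 2` (the shape of `Cruxes/…/TypedCrux.HigherSigma`) lose nothing.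
* Not here: the full algebra structure of `A` (products `Ωᵃ ⊗ Ωᵇ → Ωᵃ⁺ᵇ`, `a ≥ 2`), graded-trace identities
  (`Tr(x · At^q) = ± Tr(At^q · x)`), `At(E ⊗ E')`, functoriality in `X`, BF Prop. 4.2 / Cor. 4.3, and any
  semiregularity THEOREM (Bloch / BF Thm. 5.1 / Pridham) — those are statements about these maps, not part
  of their definition.

Requested by `defn-SemiregularityHigherSigma` (crux `SemiregularSeedsOnAnchors`, stmt-HodgeConjecture-13941,
whose typed transcription carried `σ_{q ≥ 2}` as DATA `HigherSigma k`; line `cross-ideal-orbit-transport`;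
crux `PadicPridhamSemiregularity`, stmt-HodgeConjecture-13815): the intended value of that data is
`⟨fun X E hE q => sigmaHigher hE q⟩`.
-/
noncomputable section

open CategoryTheory CategoryTheory.Abelian AlgebraicGeometry Opposite TopologicalSpace Limits

namespace Literature.AlgebraicGeometry.HodgeTheory

open Literature.AlgebraicGeometry.Modules Literature.AlgebraicGeometry.Motives

universe w u

variable {S : Type u} [CommRing S] {X : Over (Spec (CommRingCat.of S))}

/-! ### The twists `E ⊗ Ωʲ` and the twisting term `da ∧ φ` -/

section Twist

/-- **The twist `E ⊗ Ωʲ_{X/S}`, modelled as `𝓗om(E^∨, Ωʲ_{X/S})`** (canonically `≅ E ⊗ Ωʲ` for `E`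
finite locally free, Hartshorne II Ex. 5.1 (b); for `j = 1` this is `𝓗om(E^∨, ⋀¹ Ω¹) ≅ twistCotangent E`
along `Motives.hodgeSheafOneIso`). [cite: Hartshorne1977, II Ex. 5.1 (b)] -/
abbrev twistHodge (E : X.left.Modules) (j : ℕ) : X.left.Modules := sheafHom (dual E) (hodgeSheaf X j)

variable (E : X.left.Modules) (j : ℕ) {U V : X.left.Opens}

/-- `evalAt 0 = 0`. [folklore] -/
lemma evalAt_zero {F M : X.left.Modules} {U : X.left.Opens} :
    evalAt (M := M) (0 : Γ(F, U)) = 0 := by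
  have h := evalAt_add (M := M) (0 : Γ(F, U)) 0
  rw [add_zero] at h
  exact left_eq_add.mp h

/-- **The twisting term** `D(a, φ) = da ∧ φ ∈ Γ(𝓗om(E^∨, Ωʲ⁺¹), U)` for `a ∈ Γ(X, U)` and
`φ ∈ Γ(𝓗om(E^∨, Ωʲ), U)`: `φ` followed by the sheaf wedge `Ωʲ → 𝓗om(Ω¹, Ωʲ⁺¹)` (`wedgeSheafHom`)
and evaluation at the `1`-form `da` — the `Ωʲ`-twisted analogue of Atiyah's `s ⊗ da`
(`HodgeTheory.deltaHom`). [folklore] -/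
def wedgeD (U : X.left.Opens) (a : Γ(X.left, U)) (φ : (dual E).over U ⟶ (hodgeSheaf X j).over U) :
    (dual E).over U ⟶ (hodgeSheaf X (j + 1)).over U :=
  φ ≫ (SheafOfModules.overFunctor _ U).map (wedgeSheafHom X j) ≫
    evalAt (M := hodgeSheaf X (j + 1)) (dSection X U a)

/-- `D` is additive in `a`. [folklore] -/
lemma wedgeD_add_left (a b : Γ(X.left, U)) (φ : (dual E).over U ⟶ (hodgeSheaf X j).over U) :
    wedgeD E j U (a + b) φ = wedgeD E j U a φ + wedgeD E j U b φ := by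
  rw [wedgeD, wedgeD, wedgeD, dSection_add, evalAt_add, Preadditive.comp_add, Preadditive.comp_add]

/-- `D` is additive in `φ`. [folklore] -/
lemma wedgeD_add_right (a : Γ(X.left, U)) (φ ψ : (dual E).over U ⟶ (hodgeSheaf X j).over U) :
    wedgeD E j U a (φ + ψ) = wedgeD E j U a φ + wedgeD E j U a ψ := by
  rw [wedgeD, wedgeD, wedgeD, Preadditive.add_comp]

/-- `D(1, φ) = 0` (`d 1 = 0`). [folklore] -/
@[simp]
lemma wedgeD_one (φ : (dual E).over U ⟶ (hodgeSheaf X j).over U) : wedgeD E j U 1 φ = 0 := by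
  rw [wedgeD, dSection_one, evalAt_zero, comp_zero, comp_zero]

/-- `D(a, 0) = 0`. [folklore] -/
@[simp]
lemma wedgeD_zero_right (a : Γ(X.left, U)) :
    wedgeD E j U a (0 : (dual E).over U ⟶ (hodgeSheaf X j).over U) = 0 := by
  rw [wedgeD, zero_comp]

/-- `D(0, φ) = 0`. [folklore] -/
@[simp]
lemma wedgeD_zero_left (φ : (dual E).over U ⟶ (hodgeSheaf X j).over U) : wedgeD E j U 0 φ = 0 := by
  rw [wedgeD, dSection_zero, evalAt_zero, comp_zero, comp_zero]

/-- **Leibniz for `D`**: `D(ab, φ) = a D(b, φ) + b D(a, φ)`. [folklore] -/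
lemma wedgeD_mul (a b : Γ(X.left, U)) (φ : (dual E).over U ⟶ (hodgeSheaf X j).over U) :
    wedgeD E j U (a * b) φ = a • wedgeD E j U b φ + b • wedgeD E j U a φ := by
  rw [wedgeD, wedgeD, wedgeD, dSection_mul, evalAt_add, evalAt_smul, evalAt_smul,
    Preadditive.comp_add, Preadditive.comp_add, comp_smul_overHom, comp_smul_overHom,
    comp_smul_overHom, comp_smul_overHom]

/-- `D(a, b φ) = b D(a, φ)`. [folklore] -/
lemma wedgeD_smul_right (a b : Γ(X.left, U)) (φ : (dual E).over U ⟶ (hodgeSheaf X j).over U) :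
    wedgeD E j U a (b • φ) = b • wedgeD E j U a φ := by
  rw [wedgeD, wedgeD, smul_comp_overHom]

/-- `D` commutes with restriction. [folklore] -/
lemma restrictHom_wedgeD (i : V ⟶ U) (a : Γ(X.left, U))
    (φ : (dual E).over U ⟶ (hodgeSheaf X j).over U) :
    restrictHom i (wedgeD E j U a φ) =
      wedgeD E j V (X.left.presheaf.map i.op a) (restrictHom i φ) := by
  rw [wedgeD, wedgeD, restrictHom_comp, restrictHom_comp, restrictHom_over_map, restrictHom_evalAt,
    map_dSection]

end Twist

/-! ### The twisted Atiyah extensions `0 → E ⊗ Ωʲ⁺¹ → Pʲ(E) → E ⊗ Ωʲ → 0` -/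

section TwistJet

variable (E : X.left.Modules) (j : ℕ) {U V : X.left.Opens}

/-- **Sections of the `Ωʲ`-twisted jet module** over `U`: pairs `(φ, ψ)` with `φ ∈ Γ(E ⊗ Ωʲ, U)`,
`ψ ∈ Γ(E ⊗ Ωʲ⁺¹, U)` (both as `𝓗om(E^∨, –)`), with the TWISTED `𝒪(U)`-module structure
`a • (φ, ψ) = (a φ, a ψ + da ∧ φ)` (for `j = 0` and `φ = ι s`: Atiyah's `f · (s ⊕ β) = fs ⊕ (fβ + s ⊗ df)`,
see `wedgeD_toTwistHodgeZero_app`). [folklore] -/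
def TwistJetSections (U : X.left.Opens) : Type u :=
  ((dual E).over U ⟶ (hodgeSheaf X j).over U) × ((dual E).over U ⟶ (hodgeSheaf X (j + 1)).over U)

namespace TwistJetSections

/-- Additive structure: componentwise. [folklore] -/
instance instAddCommGroup (U : X.left.Opens) : AddCommGroup (TwistJetSections E j U) :=
  inferInstanceAs (AddCommGroup (((dual E).over U ⟶ (hodgeSheaf X j).over U) ×
    ((dual E).over U ⟶ (hodgeSheaf X (j + 1)).over U)))

variable {E j}

/-- Constructor. [folklore] -/
def mk (φ : (dual E).over U ⟶ (hodgeSheaf X j).over U)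
    (ψ : (dual E).over U ⟶ (hodgeSheaf X (j + 1)).over U) : TwistJetSections E j U := (φ, ψ)

/-- First component (the section of `E ⊗ Ωʲ`). [folklore] -/
def fst (p : TwistJetSections E j U) : (dual E).over U ⟶ (hodgeSheaf X j).over U := p.1

/-- Second component (the section of `E ⊗ Ωʲ⁺¹`). [folklore] -/
def snd (p : TwistJetSections E j U) : (dual E).over U ⟶ (hodgeSheaf X (j + 1)).over U := p.2

/-- `(mk φ ψ).fst = φ`. [folklore] -/
@[simp] lemma fst_mk (φ : (dual E).over U ⟶ (hodgeSheaf X j).over U)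
    (ψ : (dual E).over U ⟶ (hodgeSheaf X (j + 1)).over U) : (mk φ ψ).fst = φ := rfl
/-- `(mk φ ψ).snd = ψ`. [folklore] -/
@[simp] lemma snd_mk (φ : (dual E).over U ⟶ (hodgeSheaf X j).over U)
    (ψ : (dual E).over U ⟶ (hodgeSheaf X (j + 1)).over U) : (mk φ ψ).snd = ψ := rfl
/-- `fst` is additive. [folklore] -/
@[simp] lemma fst_add (p q : TwistJetSections E j U) : (p + q).fst = p.fst + q.fst := rfl
/-- `snd` is additive. [folklore] -/
@[simp] lemma snd_add (p q : TwistJetSections E j U) : (p + q).snd = p.snd + q.snd := rfl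
/-- `fst 0 = 0`. [folklore] -/
@[simp] lemma fst_zero : (0 : TwistJetSections E j U).fst = 0 := rfl
/-- `snd 0 = 0`. [folklore] -/
@[simp] lemma snd_zero : (0 : TwistJetSections E j U).snd = 0 := rfl

/-- Extensionality for twisted jet sections. [folklore] -/
@[ext]
lemma ext {p q : TwistJetSections E j U} (h₁ : p.fst = q.fst) (h₂ : p.snd = q.snd) : p = q :=
  Prod.ext h₁ h₂

/-- The twisted scalar multiplication `a • (φ, ψ) = (a φ, a ψ + da ∧ φ)`. [folklore] -/
instance instSMul (U : X.left.Opens) : SMul Γ(X.left, U) (TwistJetSections E j U) where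
  smul a p := mk (a • p.fst) (a • p.snd + wedgeD E j U a p.fst)

/-- First component of `a • p`. [folklore] -/
@[simp] lemma fst_smul (a : Γ(X.left, U)) (p : TwistJetSections E j U) :
    (a • p).fst = a • p.fst := rfl
/-- Second component of `a • p` (the twist). [folklore] -/
@[simp] lemma snd_smul (a : Γ(X.left, U)) (p : TwistJetSections E j U) :
    (a • p).snd = a • p.snd + wedgeD E j U a p.fst := rfl

/-- **The twisted action is a module structure** (Leibniz rule for `D`). [folklore] -/
instance instModule (U : X.left.Opens) : Module Γ(X.left, U) (TwistJetSections E j U) where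
  one_smul p := TwistJetSections.ext (one_smul _ _) (by
    change (1 : Γ(X.left, U)) • p.snd + wedgeD E j U 1 p.fst = p.snd
    rw [one_smul, wedgeD_one, add_zero])
  mul_smul a b p := TwistJetSections.ext (mul_smul a b p.fst) (by
    change (a * b) • p.snd + wedgeD E j U (a * b) p.fst =
      a • (b • p.snd + wedgeD E j U b p.fst) + wedgeD E j U a (b • p.fst)
    rw [wedgeD_mul, wedgeD_smul_right, mul_smul, smul_add]
    abel)
  smul_zero a := TwistJetSections.ext (smul_zero a) (by
    change a • (0 : (dual E).over U ⟶ (hodgeSheaf X (j + 1)).over U) + wedgeD E j U a 0 = 0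
    rw [smul_zero, wedgeD_zero_right, add_zero])
  smul_add a p q := TwistJetSections.ext (smul_add a p.fst q.fst) (by
    change a • (p.snd + q.snd) + wedgeD E j U a (p.fst + q.fst) =
      (a • p.snd + wedgeD E j U a p.fst) + (a • q.snd + wedgeD E j U a q.fst)
    rw [smul_add, wedgeD_add_right]
    abel)
  add_smul a b p := TwistJetSections.ext (add_smul a b p.fst) (by
    change (a + b) • p.snd + wedgeD E j U (a + b) p.fst =
      (a • p.snd + wedgeD E j U a p.fst) + (b • p.snd + wedgeD E j U b p.fst)
    rw [add_smul, wedgeD_add_left]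
    abel)
  zero_smul p := TwistJetSections.ext (zero_smul _ p.fst) (by
    change (0 : Γ(X.left, U)) • p.snd + wedgeD E j U 0 p.fst = 0
    rw [zero_smul, wedgeD_zero_left, add_zero])

/-- Restriction of twisted jet sections: componentwise. [folklore] -/
def restrict (i : V ⟶ U) (p : TwistJetSections E j U) : TwistJetSections E j V :=
  mk (restrictHom i p.fst) (restrictHom i p.snd)

/-- First component of a restricted section. [folklore] -/
@[simp] lemma fst_restrict (i : V ⟶ U) (p : TwistJetSections E j U) :
    (restrict i p).fst = restrictHom i p.fst := rfl
/-- Second component of a restricted section. [folklore] -/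
@[simp] lemma snd_restrict (i : V ⟶ U) (p : TwistJetSections E j U) :
    (restrict i p).snd = restrictHom i p.snd := rfl

/-- Restriction is additive. [folklore] -/
def restrictAddHom (i : V ⟶ U) : TwistJetSections E j U →+ TwistJetSections E j V where
  toFun := restrict i
  map_zero' := TwistJetSections.ext (restrictHom_zero i) (restrictHom_zero i)
  map_add' p q := TwistJetSections.ext (restrictHom_add i p.fst q.fst) (restrictHom_add i p.snd q.snd)

/-- Restriction is semilinear for the twisted structures. [folklore] -/
lemma restrict_smul (i : V ⟶ U) (a : Γ(X.left, U)) (p : TwistJetSections E j U) :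
    restrict i (a • p) = X.left.presheaf.map i.op a • restrict i p :=
  TwistJetSections.ext (restrictHom_smul i a p.fst) (by
    change restrictHom i (a • p.snd + wedgeD E j U a p.fst) =
      X.left.presheaf.map i.op a • restrictHom i p.snd +
        wedgeD E j V (X.left.presheaf.map i.op a) (restrictHom i p.fst)
    rw [restrictHom_add, restrictHom_smul, restrictHom_wedgeD])

end TwistJetSections

/-- The presheaf of abelian groups of twisted jet sections. [folklore] -/
def twistJetPresheafAb : TopCat.Presheaf Ab X.left where
  obj U := AddCommGrpCat.of (TwistJetSections E j U.unop)
  map i := AddCommGrpCat.ofHom (TwistJetSections.restrictAddHom i.unop)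
  map_id U := AddCommGrpCat.ext fun (p : TwistJetSections E j U.unop) =>
    TwistJetSections.ext (restrictHom_id' p.fst) (restrictHom_id' p.snd)
  map_comp i i' := AddCommGrpCat.ext fun (p : TwistJetSections E j _) =>
    TwistJetSections.ext (restrictHom_comp' i.unop i'.unop p.fst)
      (restrictHom_comp' i.unop i'.unop p.snd)

/-- The presheaf of modules of twisted jet sections (twisted module structures, semilinear
restriction). [folklore] -/
def twistJetPresheaf : X.left.PresheafOfModules :=
  @PresheafOfModules.ofPresheaf _ _ X.left.ringCatSheaf.obj (twistJetPresheafAb E j)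
    (fun U => TwistJetSections.instModule (E := E) (j := j) U.unop)
    (fun _ _ i a p => TwistJetSections.restrict_smul i.unop a p)

/-- **The twisted jet presheaf is a sheaf**: pairs glue componentwise (both components are
sections of internal Homs, which are sheaves). [folklore] -/
theorem isSheaf_twistJetPresheaf : TopCat.Presheaf.IsSheaf (twistJetPresheaf E j).presheaf := by
  refine (TopCat.Presheaf.isSheaf_iff_isSheafUniqueGluing _).2 fun ι U sf hsf => ?_
  let sf' : ∀ i, TwistJetSections E j (U i) := sf
  let φ₀ : ∀ i, Γ(twistHodge E j, U i) := fun i =>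
    ((sf' i).fst : (dual E).over (U i) ⟶ (hodgeSheaf X j).over (U i))
  let ψ₀ : ∀ i, Γ(twistHodge E (j + 1), U i) := fun i =>
    ((sf' i).snd : (dual E).over (U i) ⟶ (hodgeSheaf X (j + 1)).over (U i))
  have hφ₀ : TopCat.Presheaf.IsCompatible (twistHodge E j).presheaf U φ₀ := fun i i' =>
    congrArg TwistJetSections.fst (hsf i i')
  have hψ₀ : TopCat.Presheaf.IsCompatible (twistHodge E (j + 1)).presheaf U ψ₀ := fun i i' =>
    congrArg TwistJetSections.snd (hsf i i')
  obtain ⟨φ, hφ, hφ'⟩ :=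
    TopCat.Sheaf.existsUnique_gluing ((SheafOfModules.toSheaf X.left.ringCatSheaf).obj
      (twistHodge E j)) U φ₀ hφ₀
  obtain ⟨ψ, hψ, hψ'⟩ :=
    TopCat.Sheaf.existsUnique_gluing ((SheafOfModules.toSheaf X.left.ringCatSheaf).obj
      (twistHodge E (j + 1))) U ψ₀ hψ₀
  refine ⟨(TwistJetSections.mk φ ψ : TwistJetSections E j (iSup U)),
    fun i => TwistJetSections.ext (hφ i) (hψ i), fun q hq => ?_⟩
  exact TwistJetSections.ext
    (hφ' (TwistJetSections.fst (q : TwistJetSections E j (iSup U)))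
      fun i => congrArg TwistJetSections.fst (hq i))
    (hψ' (TwistJetSections.snd (q : TwistJetSections E j (iSup U)))
      fun i => congrArg TwistJetSections.snd (hq i))

/-- **The `Ωʲ`-twisted jet module `Pʲ(E)`**: the `𝒪_X`-module of pairs `(φ, ψ)`, `φ ∈ E ⊗ Ωʲ`,
`ψ ∈ E ⊗ Ωʲ⁺¹`, with `a · (φ, ψ) = (a φ, a ψ + da ∧ φ)`; it sits in the exact sequence
`0 → E ⊗ Ωʲ⁺¹ → Pʲ(E) → E ⊗ Ωʲ → 0` (`twistJetShortComplex_shortExact`) whose Yoneda class is the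
`j`-th step `E ⊗ Ωʲ → E ⊗ Ωʲ⁺¹[1]` of the Yoneda powers of the Atiyah class. For `E` finite locally free
this extension is isomorphic to the pushout along `1_E ⊗ ∧ : E ⊗ Ω¹ ⊗ Ωʲ → E ⊗ Ωʲ⁺¹` of the Atiyah sequence
tensored with `Ωʲ`: in a local frame `(e_i)` of `E`, `Σ e_i ⊗ ω_i ↦ (Σ e_i ⊗ ω_i, Σ e_i ⊗ dω_i)` is an
`𝒪`-linear local splitting, and two frames `e' = e g` give splittings differing by
`Σ_{i,k} e_i ⊗ (dg_{ik} ∧ ω'_k)` — the Atiyah cocycle `dg · g⁻¹` wedged onto the form (for `j = 0`: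
`P⁰(E) ≅ P¹(E)`, `jetToTwistJetHom`). [folklore] -/
def twistJetModule : X.left.Modules where
  val := twistJetPresheaf E j
  isSheaf := isSheaf_twistJetPresheaf E j

/-- The inclusion `E ⊗ Ωʲ⁺¹ → Pʲ(E)`, `ψ ↦ (0, ψ)`. [folklore] -/
def twistJetι : twistHodge E (j + 1) ⟶ twistJetModule E j where
  val := PresheafOfModules.homMk
    { app := fun U => AddCommGrpCat.ofHom
        { toFun := fun ψ : (dual E).over U.unop ⟶ (hodgeSheaf X (j + 1)).over U.unop =>
            (TwistJetSections.mk 0 ψ : TwistJetSections E j U.unop)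
          map_zero' := rfl
          map_add' := fun ψ ψ' => TwistJetSections.ext (add_zero _).symm rfl }
      naturality := fun {U V} i =>
        AddCommGrpCat.ext fun (ψ : (dual E).over U.unop ⟶ (hodgeSheaf X (j + 1)).over U.unop) =>
          TwistJetSections.ext (restrictHom_zero i.unop).symm rfl }
    (fun U (a : Γ(X.left, U.unop))
        (ψ : (dual E).over U.unop ⟶ (hodgeSheaf X (j + 1)).over U.unop) =>
      TwistJetSections.ext (smul_zero a).symm (by
        change a • ψ = a • ψ + wedgeD E j U.unop a 0
        rw [wedgeD_zero_right, add_zero]))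

/-- The projection `Pʲ(E) → E ⊗ Ωʲ`, `(φ, ψ) ↦ φ`. [folklore] -/
def twistJetπ : twistJetModule E j ⟶ twistHodge E j where
  val := PresheafOfModules.homMk
    { app := fun U => AddCommGrpCat.ofHom
        { toFun := fun p : TwistJetSections E j U.unop => p.fst
          map_zero' := rfl
          map_add' := fun _ _ => rfl }
      naturality := fun {U _} _ => AddCommGrpCat.ext fun (_ : TwistJetSections E j U.unop) => rfl }
    (fun U (_ : Γ(X.left, U.unop)) (_ : TwistJetSections E j U.unop) => rfl)

/-- Sections of `twistJetι`. [folklore] -/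
@[simp]
lemma twistJetι_app_apply (U : X.left.Opens)
    (ψ : (dual E).over U ⟶ (hodgeSheaf X (j + 1)).over U) :
    (twistJetι E j).app U ψ = (TwistJetSections.mk 0 ψ : TwistJetSections E j U) := rfl

/-- Sections of `twistJetπ`. [folklore] -/
@[simp]
lemma twistJetπ_app_apply (U : X.left.Opens) (p : TwistJetSections E j U) :
    (twistJetπ E j).app U p = p.fst := rfl

/-- `twistJetι ≫ twistJetπ = 0`. [folklore] -/
lemma twistJetι_comp_twistJetπ : twistJetι E j ≫ twistJetπ E j = 0 :=
  Scheme.Modules.hom_ext _ _ fun _ => AddCommGrpCat.ext fun _ => rfl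

/-- **The `Ωʲ`-twisted Atiyah sequence** `0 → E ⊗ Ωʲ⁺¹ → Pʲ(E) → E ⊗ Ωʲ → 0` as a short complex.
[folklore] -/
def twistJetShortComplex : ShortComplex X.left.Modules :=
  ShortComplex.mk (twistJetι E j) (twistJetπ E j) (twistJetι_comp_twistJetπ E j)

/-- **The twisted Atiyah sequence is short exact** (split as a sequence of abelian sheaves).
[folklore] -/
theorem twistJetShortComplex_shortExact : (twistJetShortComplex E j).ShortExact where
  exact := by
    rw [← ShortComplex.exact_map_iff_of_faithful (twistJetShortComplex E j) (modulesToSheaf X.left)]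
    refine sheaf_exact_of_sections _ _ fun U (p : TwistJetSections E j U.unop) (hp : p.fst = 0) => ?_
    exact ⟨p.snd, TwistJetSections.ext hp.symm rfl⟩
  mono_f := mono_of_injective_app (twistJetι E j) fun U ψ ψ' h => congrArg TwistJetSections.snd h
  epi_g := epi_of_surjective_app (twistJetπ E j) fun U φ => ⟨TwistJetSections.mk φ 0, rfl⟩

variable [HasExt.{w} X.left.Modules]

/-- **The `j`-th Atiyah step** `at_j(E) ∈ Ext¹(E ⊗ Ωʲ, E ⊗ Ωʲ⁺¹)`: the Yoneda class of the twisted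
Atiyah sequence (`ShortExact.extClass`). For `E` finite locally free this is `At(E) ⊗ 1_{Ωʲ}` followed by
the wedge `E ⊗ Ω¹ ⊗ Ωʲ → E ⊗ Ωʲ⁺¹`, i.e. right multiplication by `At(E)` in the Yoneda–exterior algebra
`⊕ Extⁱ(E, E ⊗ Ωʲ)` of Buchweitz–Flenner (§4, before Prop. 4.2). [cite: BuchweitzFlenner2003, §3–§4] -/
def atiyahClassStep : Ext.{w} (twistHodge E j) (twistHodge E (j + 1)) 1 :=
  (twistJetShortComplex_shortExact E j).extClass

end TwistJet

/-! ### Yoneda powers of the Atiyah class and the components `σ_q` -/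

section Sigma

variable (E : X.left.Modules) [HasExt.{w} X.left.Modules]

/-- **The Yoneda powers of the Atiyah class** `At(E)^q ∈ Ext^q(E ⊗ Ω⁰, E ⊗ Ω^q)`: the composite of
the Atiyah steps `E ⊗ Ω⁰ → E ⊗ Ω¹[1] → E ⊗ Ω²[2] → ⋯ → E ⊗ Ω^q[q]` (`At⁰ = id`). This is the `q`-th power
of `At(E)` in the (associative, not graded-commutative) Yoneda–exterior algebra
`A = ⊕_{i,j} Ext^{i}(E, E ⊗ Ωʲ)` of Buchweitz–Flenner §4. [cite: BuchweitzFlenner2003, §4 (the algebra A, At^k)] -/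
def atiyahClassPower : (q : ℕ) → Ext.{w} (twistHodge E 0) (twistHodge E q) q
  | 0 => Ext.mk₀ (𝟙 _)
  | q + 1 => (atiyahClassPower q).comp (atiyahClassStep E q) rfl

/-- `At⁰ = id`. [folklore] -/
@[simp]
lemma atiyahClassPower_zero : atiyahClassPower.{w} E 0 = Ext.mk₀ (𝟙 _) := rfl

/-- `At^{q+1} = At^q · at_q`. [folklore] -/
lemma atiyahClassPower_succ (q : ℕ) :
    atiyahClassPower.{w} E (q + 1) = (atiyahClassPower E q).comp (atiyahClassStep E q) rfl := rfl

/-- The identification `E → E ⊗ Ω⁰ = 𝓗om(E^∨, Ω⁰)`: biduality `E → E^∨∨ = 𝓗om(E^∨, 𝒪_X)`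
(`Modules.toBidual`, an isomorphism for `E` finite locally free, Hartshorne II Ex. 5.1 (a)) followed by
`𝒪_X ≅ Ω⁰` (`Motives.hodgeSheafZeroIso`). [cite: Hartshorne1977, II Ex. 5.1 (a)] -/
def toTwistHodgeZero : E ⟶ twistHodge E 0 :=
  toBidual E (unitModule X.left) ≫ sheafHomMap (dual E) (hodgeSheafZeroIso X).inv

variable {E} (hE : IsFiniteLocallyFree E)

/-- **The higher semiregularity component** `σ_q : Ext²_{𝒪_X}(E, E) → H^{q+2}(X, Ω^q_{X/S})`
(`= Motives.hodgeCohomology X q (q + 2)`) of a finite locally free `E` on an `S`-scheme `X`, for every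
`q : ℕ`: `σ_q(x) = Tr_{Ω^q}(x · At(E)^q)` — compose `x ∈ Ext²(E, E)` with `E → E ⊗ Ω⁰`
(`toTwistHodgeZero`) and the Yoneda power `At(E)^q ∈ Ext^q(E ⊗ Ω⁰, E ⊗ Ω^q)` (`atiyahClassPower`), then
apply the trace with coefficients `Ω^q`, `Ext^{q+2}(E, 𝓗om(E^∨, Ω^q)) → H^{q+2}(X, Ω^q)`
(`traceCoeffToCohomology`). This is the form-degree-`q` component of the Buchweitz–Flenner semiregularity
map `σ = Tr(∗ · exp(-At)) : Ext²(F, F) → ∏_q H^{q+2}(X, Λ^q 𝕃)` (Def. 4.1; for `X/S` with `𝕃` replaced by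
`Ω¹_{X/S}`), WITHOUT the scalar `(-1)^q/q!` of `exp(-At)` (BLM: `τ_q(x) = ((-1)^q/q!) Tr(At(F)^q x)`): the
targets are only abelian groups here, and when `q!` is invertible on `H^{q+2}(X, Ω^q)` (e.g. `q < p` on a
`k`-scheme, `char k = p`) the kernel — hence `q`-semiregularity — is unchanged.
[cite: BuchweitzFlenner2003, Def. 4.1] [cite: BandieraLepriManetti2023, §1 (τ_k)] -/
def sigmaHigher (q : ℕ) : Ext.{w} E E 2 →+ hodgeCohomology X q (q + 2) :=
  (traceCoeffToCohomology hE (hodgeSheaf X q) (q + 2)).comp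
    (((atiyahClassPower E q).postcomp E (add_comm 2 q)).comp
      ((Ext.mk₀ (toTwistHodgeZero E)).postcomp E (add_zero 2)))

/-- Unfolding `σ_q`: `σ_q(x) = Tr_{Ω^q}((x · ι) · At(E)^q)` with `ι : E → E ⊗ Ω⁰`.
[cite: BuchweitzFlenner2003, Def. 4.1] -/
lemma sigmaHigher_apply (q : ℕ) (x : Ext.{w} E E 2) :
    sigmaHigher hE q x = traceCoeffToCohomology hE (hodgeSheaf X q) (q + 2)
      ((x.comp (Ext.mk₀ (toTwistHodgeZero E)) (add_zero 2)).comp (atiyahClassPower E q)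
        (add_comm 2 q)) :=
  rfl

/-- **`E` is `q`-semiregular**: `σ_q : Ext²(E, E) → H^{q+2}(X, Ω^q)` is injective ("`ℱ` is
`k`-semiregular if the component `σ_k` of `σ` is injective", BF §1). [cite: BuchweitzFlenner2003, §1 (k-semiregular)] -/
def IsHigherSemiregular (q : ℕ) : Prop :=
  Function.Injective (sigmaHigher.{w} hE q)

/-- **`E` is `I`-semiregular** for a set `I` of form degrees: the part `(σ_q)_{q ∈ I}` of the
semiregularity map is (jointly) injective, i.e. `σ_q(x) = 0` for all `q ∈ I` forces `x = 0` ("`ℰ₀` is called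
`I`-semiregular if the part `σ_I` of the semiregularity map is injective", BF §5; e.g. `I = {q | q < p}` is
the p-adic notion). [cite: BuchweitzFlenner2003, §5 (I-semiregular)] -/
def IsISemiregular (I : Set ℕ) : Prop :=
  ∀ x : Ext.{w} E E 2, (∀ q ∈ I, sigmaHigher hE q x = 0) → x = 0

/-- `q`-semiregular is `{q}`-semiregular. [cite: BuchweitzFlenner2003, §5] -/
theorem isHigherSemiregular_iff_isISemiregular_singleton (q : ℕ) :
    IsHigherSemiregular.{w} hE q ↔ IsISemiregular.{w} hE {q} := by
  constructor
  · intro h x hx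
    exact h ((hx q rfl).trans (map_zero _).symm)
  · intro h x y hxy
    refine sub_eq_zero.mp (h _ fun q' hq' => ?_)
    rw [Set.mem_singleton_iff.mp hq', map_sub, sub_eq_zero]
    exact hxy

/-- `I`-semiregularity is monotone in `I`: more components can only shrink the joint kernel.
[cite: BuchweitzFlenner2003, §5] -/
theorem IsISemiregular.mono {I J : Set ℕ} (hIJ : I ⊆ J) (h : IsISemiregular.{w} hE I) :
    IsISemiregular.{w} hE J :=
  fun x hx => h x fun q hq => hx q (hIJ hq)

end Sigma

/-! ### Sections of the inverse isomorphisms `𝒪_X ≅ Ω⁰`, `Ω¹ ≅ ⋀¹ Ω¹` through `toHodgeSheaf` -/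

section UnitCounit

/-- For a SHEAF of modules `M`, the inverse of the counit isomorphism `(M.val)^sh ≅ M`
(`Motives.sheafificationValIso`) is, on underlying presheaves, the unit `M.val → ((M.val)^sh).val` of the
sheafification adjunction (triangle identity). [folklore] -/
lemma sheafificationValIso_inv_val (M : X.left.Modules) :
    (PresheafOfModules.restrictScalars (𝟙 X.left.ringCatSheaf.obj)).map
        (sheafificationValIso M).inv.val =
      (PresheafOfModules.sheafificationAdjunction (𝟙 X.left.ringCatSheaf.obj)).unit.app
        ((SheafOfModules.forget _ ⋙
          PresheafOfModules.restrictScalars (𝟙 X.left.ringCatSheaf.obj)).obj M) := by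
  rw [← Adjunction.inv_counit_map]
  change (SheafOfModules.forget _ ⋙ PresheafOfModules.restrictScalars (𝟙 X.left.ringCatSheaf.obj)).map
    (inv ((PresheafOfModules.sheafificationAdjunction (𝟙 X.left.ringCatSheaf.obj)).counit.app M)) = _
  rw [Functor.map_inv]

/-- Sections of `(𝒪_X ≅ Ω⁰)⁻¹`: `r ↦` the image in `Ω⁰` of `r • () ∈ ⋀⁰ Γ(W, Ω¹)`. [folklore] -/
lemma hodgeSheafZeroIso_inv_app (W : X.left.Opens) (r : Γ(unitModule X.left, W)) :
    (hodgeSheafZeroIso X).inv.app W r = (toHodgeSheaf X 0).app (op W)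
      ((exteriorPowerPresheafZeroIso (formsOne X)).inv.app (op W) r) := by
  have h1 : (hodgeSheafZeroIso X).inv.app W r =
      ((PresheafOfModules.sheafification (𝟙 X.left.ringCatSheaf.obj)).map
        (exteriorPowerPresheafZeroIso (formsOne X)).inv).val.app (op W)
        ((sheafificationValIso (unitModule X.left)).inv.val.app (op W) r) := rfl
  have h2 := congrArg (fun φ => (PresheafOfModules.Hom.app φ (op W)).hom r)
    (sheafificationValIso_inv_val (unitModule X.left))
  have h3 := congrArg (fun φ => (PresheafOfModules.Hom.app φ (op W)).hom r)
    ((PresheafOfModules.sheafificationAdjunction (𝟙 X.left.ringCatSheaf.obj)).unit.naturality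
      (exteriorPowerPresheafZeroIso (formsOne X)).inv)
  rw [h1]
  erw [h2]
  exact h3.symm

/-- Sections of `(Ω¹ ≅ ⋀¹ Ω¹)⁻¹`: `m ↦` the image in `⋀¹ Ω¹` of `m ∈ ⋀¹ Γ(W, Ω¹)`. [folklore] -/
lemma hodgeSheafOneIso_inv_app (W : X.left.Opens) (m : Γ(cotangentSheaf X, W)) :
    (hodgeSheafOneIso X).inv.app W m = (toHodgeSheaf X 1).app (op W)
      ((exteriorPowerPresheafOneIso (formsOne X)).inv.app (op W) m) := by
  have h1 : (hodgeSheafOneIso X).inv.app W m =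
      ((PresheafOfModules.sheafification (𝟙 X.left.ringCatSheaf.obj)).map
        (exteriorPowerPresheafOneIso (formsOne X)).inv).val.app (op W)
        ((sheafificationValIso (cotangentSheaf X)).inv.val.app (op W) m) := rfl
  have h2 := congrArg (fun φ => (PresheafOfModules.Hom.app φ (op W)).hom m)
    (sheafificationValIso_inv_val (cotangentSheaf X))
  have h3 := congrArg (fun φ => (PresheafOfModules.Hom.app φ (op W)).hom m)
    ((PresheafOfModules.sheafificationAdjunction (𝟙 X.left.ringCatSheaf.obj)).unit.naturality
      (exteriorPowerPresheafOneIso (formsOne X)).inv)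
  rw [h1]
  erw [h2]
  exact h3.symm

end UnitCounit

/-! ### The wedge with the unit of `⋀⁰` and with `1`-forms placed in `⋀¹` -/

section WedgeUnit

variable {A : Type u} [CommRing A] {M : ModuleCat.{u} A}

/-- `![m] = fun _ ↦ m` on `Fin 1`. [folklore] -/
lemma vecCons_vecEmpty_eq_const (m : M) : (![m] : Fin 1 → M) = fun _ => m := by
  funext i
  fin_cases i
  rfl

/-- `(⋀⁰ M ≅ A)⁻¹ r = r • ()` (the empty wedge). [folklore] -/
lemma exteriorPower_iso₀_inv_apply (r : A) :
    (ModuleCat.exteriorPower.iso₀ M).inv r = r • ModuleCat.exteriorPower.mk (M := M) ![] := by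
  change r • exteriorPower.ιMulti A 0 _ = r • exteriorPower.ιMulti A 0 _
  congr 1

/-- `(⋀¹ M ≅ M)⁻¹ m = m` as a `1`-fold wedge. [folklore] -/
lemma exteriorPower_iso₁_inv_apply (m : M) :
    (ModuleCat.exteriorPower.iso₁ M).inv m = ModuleCat.exteriorPower.mk (M := M) ![m] := by
  change exteriorPower.ιMulti A 1 (fun _ => m) = exteriorPower.ιMulti A 1 ![m]
  rw [vecCons_vecEmpty_eq_const]

/-- `θ ∧ (r • ()) = (r • θ)` placed in `⋀¹ M`. [folklore] -/
lemma wedgeLeftHom_iso₀_inv (θ : M) (r : A) :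
    wedgeLeftHom M 0 θ ((ModuleCat.exteriorPower.iso₀ M).inv r) =
      (ModuleCat.exteriorPower.iso₁ M).inv (r • θ) := by
  rw [exteriorPower_iso₀_inv_apply, map_smul, map_smul, wedgeLeftHom_mk,
    exteriorPower_iso₁_inv_apply]

end WedgeUnit

/-! ### The first Atiyah step is the Atiyah class -/

section StepZero

variable {U W : X.left.Opens}

/-- **`θ ∧ e₀⁻¹(r) = e₁⁻¹(r θ)`**: wedging a `1`-form `θ` with the image in `Ω⁰` of a function `r`
(along `(𝒪_X ≅ Ω⁰)⁻¹`) gives the image in `⋀¹ Ω¹` of `r θ` (along `(Ω¹ ≅ ⋀¹ Ω¹)⁻¹`). [folklore] -/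
lemma appLE_wedgeSheafHom_hodgeSheafZeroIso_inv (r : Γ(unitModule X.left, W))
    (θ : Γ(cotangentSheaf X, W)) :
    appLE ((wedgeSheafHom X 0).app W ((hodgeSheafZeroIso X).inv.app W r) :
        (cotangentSheaf X).over W ⟶ (hodgeSheaf X 1).over W) (𝟙 W) θ =
      (hodgeSheafOneIso X).inv.app W ((show Γ(X.left, W) from r) • θ) := by
  rw [hodgeSheafZeroIso_inv_app]
  erw [wedgeSheafHom_app_toHodgeSheaf]
  rw [appLE_wedgeHom, wedgeSection, hodgeSheafOneIso_inv_app, op_id]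
  erw [presheafOfModules_map_id_apply]
  exact congrArg _ (wedgeLeftHom_iso₀_inv (M := (formsOne X).obj (op W)) θ r)

/-- Morphism form of `appLE_wedgeSheafHom_hodgeSheafZeroIso_inv`: on `𝒪_X|_U`,
`e₀⁻¹` then `∧` then evaluation at `θ` equals multiplication by `θ` then `e₁⁻¹`. [folklore] -/
lemma hodgeSheafZeroIso_inv_wedge_evalAt (θ : Γ(cotangentSheaf X, U)) :
    (SheafOfModules.overFunctor _ U).map (hodgeSheafZeroIso X).inv ≫
        (SheafOfModules.overFunctor _ U).map (wedgeSheafHom X 0) ≫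
          evalAt (M := hodgeSheaf X 1) θ =
      smulSection θ ≫ (SheafOfModules.overFunctor _ U).map (hodgeSheafOneIso X).inv :=
  hom_ext_of_appLE fun W k r => by
    rw [appLE_comp, appLE_comp, appLE_over_map, appLE_over_map, appLE_evalAt, appLE_comp,
      appLE_over_map]
    erw [appLE_smulSection]
    exact appLE_wedgeSheafHom_hodgeSheafZeroIso_inv r _

variable (E : X.left.Modules)

/-- Sections of `toTwistHodgeZero`: `s ↦ ev_s ≫ e₀⁻¹`. [folklore] -/
lemma toTwistHodgeZero_app_apply (U : X.left.Opens) (s : Γ(E, U)) :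
    (toTwistHodgeZero E).app U s = evalAt (M := unitModule X.left) s ≫
      (SheafOfModules.overFunctor _ U).map (hodgeSheafZeroIso X).inv := rfl

/-- **The twisting terms match**: `D(a, ι s) = δ(a, s) ≫ e₁⁻¹` — the `Ω⁰`-twisted term `da ∧ (ι s)` of
`twistJetModule E 0` on the image `ι s` of `s ∈ E` is Atiyah's `s ⊗ da` (`deltaHom`) placed in
`⋀¹ Ω¹`. [folklore] -/
lemma wedgeD_toTwistHodgeZero_app (U : X.left.Opens) (a : Γ(X.left, U)) (s : Γ(E, U)) :
    wedgeD E 0 U a ((toTwistHodgeZero E).app U s) =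
      deltaHom E U a s ≫ (SheafOfModules.overFunctor _ U).map (hodgeSheafOneIso X).inv := by
  rw [toTwistHodgeZero_app_apply, wedgeD, deltaHom, Category.assoc, Category.assoc,
    hodgeSheafZeroIso_inv_wedge_evalAt]

/-- `toTwistHodgeZero` on restricted sections. [folklore] -/
lemma restrictHom_toTwistHodgeZero_app {V : X.left.Opens} (i : V ⟶ U) (s : Γ(E, U)) :
    restrictHom i ((toTwistHodgeZero E).app U s) =
      (toTwistHodgeZero E).app V (E.presheaf.map i.op s) :=
  (PresheafOfModules.naturality_apply (toTwistHodgeZero E).val i.op s).symm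

/-- **The comparison map `P¹(E) → P⁰-twisted jet module`**: `(s, β) ↦ (ι s, β ≫ e₁⁻¹)` — a morphism
of `𝒪_X`-modules thanks to `wedgeD_toTwistHodgeZero_app`. [folklore] -/
def jetToTwistJet : jetModule E ⟶ twistJetModule E 0 where
  val := PresheafOfModules.homMk
    { app := fun U => AddCommGrpCat.ofHom
        { toFun := fun p : JetSections E U.unop =>
            (TwistJetSections.mk ((toTwistHodgeZero E).app U.unop p.fst)
              (p.snd ≫ (SheafOfModules.overFunctor _ U.unop).map (hodgeSheafOneIso X).inv) :
                TwistJetSections E 0 U.unop)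
          map_zero' := TwistJetSections.ext (map_zero ((toTwistHodgeZero E).app U.unop).hom)
            (zero_comp (X := (dual E).over U.unop))
          map_add' := fun p q => TwistJetSections.ext
            (map_add ((toTwistHodgeZero E).app U.unop).hom p.fst q.fst) (Preadditive.add_comp ..) }
      naturality := fun {U V} i =>
        AddCommGrpCat.ext fun (p : JetSections E U.unop) => TwistJetSections.ext
          (restrictHom_toTwistHodgeZero_app E i.unop p.fst).symm
          (by
            change restrictHom i.unop p.snd ≫ _ = restrictHom i.unop (p.snd ≫ _)
            rw [restrictHom_comp, restrictHom_over_map]) }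
    (fun U (a : Γ(X.left, U.unop)) (p : JetSections E U.unop) => TwistJetSections.ext
      (Scheme.Modules.Hom.app_smul (toTwistHodgeZero E) a p.fst)
      (by
        change (a • p.snd + deltaHom E U.unop a p.fst) ≫ _ =
          a • (p.snd ≫ _) + wedgeD E 0 U.unop a ((toTwistHodgeZero E).app U.unop p.fst)
        rw [Preadditive.add_comp, smul_comp_overHom, wedgeD_toTwistHodgeZero_app]))

/-- Sections of `jetToTwistJet`. [folklore] -/
@[simp]
lemma jetToTwistJet_app_apply (U : X.left.Opens) (p : JetSections E U) :
    (jetToTwistJet E).app U p = (TwistJetSections.mk ((toTwistHodgeZero E).app U p.fst)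
      (p.snd ≫ (SheafOfModules.overFunctor _ U).map (hodgeSheafOneIso X).inv) :
        TwistJetSections E 0 U) := rfl

/-- **The morphism of extensions** from the Atiyah sequence `0 → E ⊗ Ω¹ → P¹(E) → E → 0` to the
`Ω⁰`-twisted one `0 → 𝓗om(E^∨, ⋀¹Ω¹) → P⁰(E) → 𝓗om(E^∨, Ω⁰) → 0`, over `ι : E → 𝓗om(E^∨, Ω⁰)` and
`e₁⁻¹ : 𝓗om(E^∨, Ω¹) → 𝓗om(E^∨, ⋀¹ Ω¹)`. [folklore] -/
def jetToTwistJetHom : jetShortComplex E ⟶ twistJetShortComplex E 0 where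
  τ₁ := sheafHomMap (dual E) (hodgeSheafOneIso X).inv
  τ₂ := jetToTwistJet E
  τ₃ := toTwistHodgeZero E
  comm₁₂ := Scheme.Modules.hom_ext _ _ fun U => AddCommGrpCat.ext
    fun (_ : (dual E).over U ⟶ (cotangentSheaf X).over U) => TwistJetSections.ext
      (map_zero ((toTwistHodgeZero E).app U).hom).symm rfl
  comm₂₃ := Scheme.Modules.hom_ext _ _ fun U => AddCommGrpCat.ext fun (_ : JetSections E U) => rfl

variable [HasExt.{w} X.left.Modules]

/-- **The first Atiyah step is the Atiyah class**: in `Ext¹(E, 𝓗om(E^∨, ⋀¹ Ω¹))`,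
`At(E) · e₁⁻¹ = ι · at₀(E)` — the Yoneda class of the `Ω⁰`-twisted Atiyah sequence pulled back along
`ι : E → E ⊗ Ω⁰` is the Atiyah class of `HodgeTheory/AtiyahClass.lean` pushed along
`Ω¹ ≅ ⋀¹ Ω¹` (naturality of `ShortExact.extClass` for `jetToTwistJetHom`).
[cite: BuchweitzFlenner2003, §3 (Atiyah class)] -/
theorem atiyahClass_comp_hodgeSheafOneIso_inv :
    (atiyahClass E).comp (Ext.mk₀ (sheafHomMap (dual E) (hodgeSheafOneIso X).inv)) (add_zero 1) =
      (Ext.mk₀ (toTwistHodgeZero E)).comp (atiyahClassStep.{w} E 0) (zero_add 1) :=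
  (jetShortComplex_shortExact E).extClass_naturality (twistJetShortComplex_shortExact E 0)
    (jetToTwistJetHom E)

end StepZero

/-! ### `σ_0`, `σ_1` are the tree's `sigmaZero`, `sigmaOne` -/

section SigmaCompat

variable {E : X.left.Modules} [HasExt.{w} X.left.Modules] (hE : IsFiniteLocallyFree E)

/-- **`σ_1` agrees with `HodgeTheory.sigmaOne`**: under the comparison
`H³(X, ⋀¹ Ω¹) ≃+ hodgeCohomologyOne X 3` (`Motives.hodgeCohomologyOneAddEquiv`), the component `σ_1` of
this file (first Yoneda power of the Atiyah class on `𝓗om(E^∨, Ω^•)`) is the tree's real `σ_1`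
(`AtiyahClassTraceReal.sigmaOne`, `Tr(At(E) ∘ x)`). [cite: BuchweitzFlenner2003, Def. 4.1] -/
theorem hodgeCohomologyOneAddEquiv_sigmaHigher_one (x : Ext.{w} E E 2) :
    hodgeCohomologyOneAddEquiv X 3 (sigmaHigher hE 1 x) = sigmaOne hE x := by
  have h1 : (x.comp (Ext.mk₀ (toTwistHodgeZero E)) (add_zero 2)).comp (atiyahClassPower E 1)
      (add_comm 2 1) = (x.comp (atiyahClass E) (rfl : 2 + 1 = 3)).comp
        (Ext.mk₀ (sheafHomMap (dual E) (hodgeSheafOneIso X).inv)) (add_zero 3) := by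
    rw [atiyahClassPower_succ, atiyahClassPower_zero, Ext.mk₀_id_comp,
      Ext.comp_assoc_of_second_deg_zero, ← atiyahClass_comp_hodgeSheafOneIso_inv,
      ← Ext.comp_assoc_of_third_deg_zero]
  rw [sigmaHigher_apply, h1, traceCoeffToCohomology_comp_mk₀, hodgeCohomologyOneAddEquiv_apply,
    ← sigmaOne_apply]
  exact sheafH_map_hom_map_inv ((SheafOfModules.toSheaf _).mapIso (hodgeSheafOneIso X)) 3 _

/-- **`σ_0` agrees with `HodgeTheory.sigmaZero`**: under `H²(X, Ω⁰) ≃+ H²(X, 𝒪_X)`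
(`Motives.hodgeCohomologyZeroAddEquiv`), the component `σ_0` of this file is the trace
`σ_0 = Tr : Ext²(E, E) → H²(X, 𝒪_X)` of `AtiyahClassTraceReal`. [cite: BuchweitzFlenner2003, §1 (σ_0)] -/
theorem hodgeCohomologyZeroAddEquiv_sigmaHigher_zero (x : Ext.{w} E E 2) :
    hodgeCohomologyZeroAddEquiv X 2 (sigmaHigher hE 0 x) = sigmaZero hE x := by
  have h1 : (x.comp (Ext.mk₀ (toTwistHodgeZero E)) (add_zero 2)).comp (atiyahClassPower E 0)
      (add_comm 2 0) = (extToBidual E 2 x).comp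
        (Ext.mk₀ (sheafHomMap (dual E) (hodgeSheafZeroIso X).inv)) (add_zero 2) := by
    rw [atiyahClassPower_zero, Ext.comp_mk₀_id, toTwistHodgeZero, ← Ext.mk₀_comp_mk₀,
      ← Ext.comp_assoc_of_third_deg_zero]
    rfl
  rw [sigmaHigher_apply, h1, traceCoeffToCohomology_comp_mk₀, hodgeCohomologyZeroAddEquiv_apply,
    sigmaZero_apply, traceExt_eq]
  exact sheafH_map_hom_map_inv ((SheafOfModules.toSheaf _).mapIso (hodgeSheafZeroIso X)) 2 _

end SigmaCompat

end Literature.AlgebraicGeometry.HodgeTheory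

end
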